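/-
Copyright: lit-balaban cell, Phase-2 proof seat p24 (gen 23).  Released under Apache 2.0 license as described in the
file LICENSE.
-/
import Literature.MathematicalPhysics.QuantumFieldTheory.Balaban1983to89.B4Eq243Transform
import Literature.Analysis.FunctionSpaces.LatticeParseval

/-!
# `Balaban1983to89.B4Eq243TransformSummable` — [Balaban1983RegularityDecay] p. 584, **(2.43)** for SUMMABLE functions on
# the fine lattice `ξℤ^d`: the transform as a lattice sum, the inversion formula AS PRINTED, and the first summand of
# **(2.45)** (the symbol of `−Δ^ξ + m²`)

statement-level skeleton of published theorems with citation tags; proofs where landed; nothing here is a claim about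
the Yang–Mills mass gap

CITATION HEADER.  T. Bałaban, *Regularity and decay of lattice Green's functions*, Commun. Math. Phys. **89** (1983)
571–597, doi:10.1007/bf01214744 [Balaban1983RegularityDecay] (cell paper B4; held text
`paper:balaban1983-cmp89-regularity-decay`, journal page = PDF page + 570), p. 584 [PDF 14]; render
`pub-balaban/b2b-balaban-ref1/pages/1983-cmp89-regularity-decay/1983-cmp89-regularity-decay-p014-x2.png` read as an
image by this seat (unit `lit-balaban-p24` gen 23; HOME `run/shared/lean/pub/lit-balaban/`; SKELETON row **B4.Eq2.43** =
displays (2.43)–(2.48), the B4 owner's audit `lit-balaban-r01/AUDIT-B4-DEF-g42.md` §Plan).  The owner's `B4Eq243Transform`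
(p361469) types (2.43) for FINITELY SUPPORTED `f` with the support `S` as a datum (`ft n S f P`); the present file is its
extension to SUMMABLE `f` — needed because the propagator columns `φ₀ = G_jf` of (2.44), to which print applies the transform
in (2.45), are never finitely supported — with the bridge `ftSum_eq_ft`, plus the `−Δ^ξ + m²` half of the audit's member 3;
the aliasing identity of `Q_j^*Q_j` and (2.44) ⇒ (2.45) are the sibling `B4Eq245Aliasing`, the fibrewise solution (2.46) is
the owner's `B4Eq246Fibre`.

WHAT IS PRINTED (p. 584, verbatim).  «Now we will construct an explicit representation for G_j. Let us introduce a
Fourier transform on ξZ^d by the formulas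
  f̃(p) = Σ_x ξ^d e^{−ip·x} f(x),   f(x) = (2π)^{−d} ∫_{|p|≤π/ξ} e^{ix·p} f̃(p).   (2.43)
We apply it to the basic equation
  (−Δ^ξ + m_j² + a_jQ_j^*Q_j)φ₀ = f.   (2.44)
Defining the propagator G_j, φ₀ = G_jf, we get
  Δ^ξ(p)φ̃₀(p) + a_ju_j(p) Σ_{l′} \overline{u_j(p′+l′)} φ̃₀(p′+l′) = f̃(p),  […]
  Δ^ξ(p) = Σ_{μ=1}^d |(e^{−iξp_μ} − 1)/ξ|² + m_j²,  p′ ∈ [−π,π[^d, […]   (2.45)»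
(`ξ = L^{−j}`; «□ is written as □ = {x ∈ ξZ^d : …}», p. 584, so `x` ranges over the fine lattice `ξZ^d`.)

WHAT THIS MODULE PROVES (kernel-checked; 3 definitions WITH BODIES (`ftTerm`, `ftSum`, `bigZone`) + theorems; 0 `sorry`;
0 `Prop` facts; axioms standard).  Dictionary of `B4Green244` (fine point `z ∈ ℤ^d`, `x = ξz`, `ξ = 1/n`, `n = L^j ≥ 1`;
complex momenta `p : Fin d → ℂ` as in `PhZ`/`shift`/`V`/`DeltaXi`, i.e. print's FINE momentum `p = p′ + l`, un-rescaled;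
`phaseC p z = p·z`):
* `ftSum n φ p` = **(2.43), first formula, as the lattice SUM** `f̃(p) = ξ^d Σ'_z e^{−ip·ξz} f(z)` (`tsum` over `ℤ^d`): the
  finite sum for finitely supported `φ` (`ftSum_eq_sum`; entire in `p`, `differentiable_ftSum`), absolutely convergent at
  every REAL momentum for `φ ∈ ℓ¹(ℤ^d)` (`summable_ftTerm_ofRealVec`);
* **`ftSum_eq_ft` / `ft_eq_ftSum`** — agreement with the owner's `B4Eq243Transform.ft`: `ftSum n f (nP) = ft n S f P` for `f`
  vanishing off `S` (one transform in the dictionary, two readings: support-indexed finite sum, and lattice sum);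
* `ftSum_ofRealVec_eq_fourier` — bridge to the tree's `Literature.Analysis.FunctionSpaces.Lattice.fourier` (Madras–Slade
  sign, unit lattice): `f̃(p) = ξ^d·(Lattice.fourier f)(−ξp)`, so Parseval (`Lattice.tsum_enorm_sq_eq_lintegral_cube`) applies;
* `ftSum_comp_add` / `ftSum_comp_sub` (translation law), `ftSum_periodic` (`2πn`-periodicity in each `p_μ`);
* **`ftSum_negLap`**, **`ftSum_negLap_add_mass`** — THE FIRST SUMMAND OF (2.45): `(−Δ^ξφ + m²φ)~(p) = Δ^ξ(p)·φ̃(p)`, print's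
  `Δ^ξ(p) = Σ_μ |(e^{−iξp_μ} − 1)/ξ|² + m²` = `B4Strip.DeltaXi n m² p`, `−Δ^ξ = B4Green244.negLap n` (the plane-wave eigenvalue of
  `B4Green244.lap_PhZ`, now for every `φ` whose series (2.43) converges at `p`);
* **`ftSum_inversion`** — **(2.43), SECOND FORMULA, AS PRINTED**, for `φ ∈ ℓ¹(ℤ^d)`:
  `f(x) = (2π)^{−d} ∫_{|p_μ|≤π/ξ} e^{ix·p} f̃(p) dp` over the cube `bigZone d n = [−nπ, nπ]^d`, obtained from the `latticeKernel`
  form `ftSum_inversion_latticeKernel` (`φ z = latticeKernel (P ↦ n^d f̃(nP)) z`, the `(2π)^{−d}∫_{[−π,π]^d}` functional of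
  `B4ContourShift` used by `B4Green244` and by the owner's `inversion243`) by the substitution `p = nP`
  (`Measure.integral_comp_smul`); its heart `latticeKernel_tsum_phase`: the kernel of the absolutely convergent series
  `Σ_y e^{−iP·y} φ(y)` is `φ` (term-wise integration + `B4Green244.latticeKernel_phase`);
* `eq_of_ftSum_eq` — injectivity: two `ℓ¹` functions with the same transform on the big zone are equal.

DICTIONARY / HONEST SCOPE.  (i) Momentum variable = print's `p`, `|p_μ| ≤ π/ξ = nπ` (the owner's `ft` uses `P = ξp`; bridge
above); fibre representatives `k_μ ∈ {0,…,n−1}` (`B4Strip.shift`) instead of the printed symmetric `m′_μ` (same values by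
`ftSum_periodic`).  (ii) Scalar `φ` (print's `R^N`-valued `φ` componentwise; (2.44) is colour-diagonal at `A = 0`).
(iii) Inversion and injectivity for `φ ∈ ℓ¹(ℤ^d)` (`Summable ‖φ ·‖`) — the class containing every finitely supported `f` and,
by Lemma 2.4 / `B4Green244.K_decay`, the propagator columns; print names no function class.  (iv) NOT here: the aliasing
identity, (2.44) ⇒ (2.45), (2.46) (siblings named above); `ℓ²` theory beyond the Parseval bridge.  Value = kernel certificate
of one printed definition and two printed identities of [B4] §2; NOT summit progress.
-/


namespace Literature.MathematicalPhysics.QuantumFieldTheory.Balaban1983to89.B4Eq243TransformSummable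

open Complex Finset MeasureTheory
open Literature.MathematicalPhysics.QuantumFieldTheory.Balaban1983to89.B4Strip
open Literature.MathematicalPhysics.QuantumFieldTheory.Balaban1983to89.B4ContourShift
open Literature.MathematicalPhysics.QuantumFieldTheory.Balaban1983to89.B4StripSums
open Literature.MathematicalPhysics.QuantumFieldTheory.Balaban1983to89.B4StripSumsHolder
open Literature.MathematicalPhysics.QuantumFieldTheory.Balaban1983to89.B4Green244
open Literature.MathematicalPhysics.QuantumFieldTheory.Balaban1983to89.B4Eq243Transform
open scoped Real

noncomputable section

variable {d : ℕ}

/-! ### §1 The phase `p·z` at complex momentum: additivity, the real case -/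

/-- additivity of the complex phase in the lattice point. [folklore] -/
private theorem phaseC_add (P : Fin d → ℂ) (x y : Fin d → ℤ) : phaseC P (x + y) = phaseC P x + phaseC P y := by
  unfold phaseC
  rw [← Finset.sum_add_distrib]
  refine Finset.sum_congr rfl fun μ _ => ?_
  rw [Pi.add_apply]; push_cast; ring

/-- subtractivity of the complex phase in the lattice point. [folklore] -/
private theorem phaseC_sub (P : Fin d → ℂ) (x y : Fin d → ℤ) : phaseC P (x - y) = phaseC P x - phaseC P y := by
  rw [sub_eq_add_neg, phaseC_add, phaseC_neg, ← sub_eq_add_neg]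

/-- the phase at the unit vector `e_μ` is the `μ`-th momentum component. [folklore] -/
private theorem phaseC_e (P : Fin d → ℂ) (μ : Fin d) : phaseC P (e μ) = P μ := by
  unfold phaseC e
  rw [Finset.sum_eq_single μ]
  · simp
  · intro ν _ hν
    simp [Pi.single_eq_of_ne hν]
  · intro h; exact absurd (Finset.mem_univ μ) h

/-- the phase scales linearly in the momentum: `(cP)·z = c(P·z)`. [folklore] -/
private theorem phaseC_smul (c : ℂ) (P : Fin d → ℂ) (x : Fin d → ℤ) : phaseC (fun μ => c * P μ) x = c * phaseC P x := by
  unfold phaseC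
  rw [Finset.mul_sum]
  refine Finset.sum_congr rfl fun μ _ => ?_
  ring

/-- at a real momentum the plane wave has modulus one: `|e^{−ip·ξz}| = 1`. [folklore] -/
private theorem norm_cexp_neg_phaseC_ofRealVec (n : ℕ) (p : Fin d → ℝ) (z : Fin d → ℤ) :
    ‖cexp (-(I * phaseC (ofRealVec p) z / n))‖ = 1 := by
  rw [phaseC_ofRealVec]
  have h : -(I * phase p z / n) = ((-(∑ μ, p μ * (z μ : ℝ)) / n : ℝ) : ℂ) * I := by
    unfold phase; push_cast; ring
  rw [h, Complex.norm_exp_ofReal_mul_I]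

/-! ### §2 (2.43), first formula: the transform WITH ITS BODY -/

/-- one term of the series (2.43): `e^{−ip·x} f(x)` at the fine point `x = ξz` (the weight `ξ^d` is put in front of the
sum). [cite: Balaban1983RegularityDecay, (2.43) p.584] -/
def ftTerm (n : ℕ) (φ : (Fin d → ℤ) → ℂ) (p : Fin d → ℂ) (z : Fin d → ℤ) : ℂ :=
  cexp (-(I * phaseC p z / n)) * φ z

/-- **(2.43), FIRST FORMULA, WITH ITS BODY.**  The Fourier transform on the fine lattice `ξℤ^d`, `ξ = 1/n`:
`f̃(p) = Σ_x ξ^d e^{−ip·x} f(x)`, `x = ξz`, `z ∈ ℤ^d`, i.e. `ftSum n φ p = ξ^d Σ'_z e^{−ip·z/n} φ(z)`, for a complex momentum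
`p` (print: `|p_μ| ≤ π/ξ` real; the tree's fibre momenta `p′ + 2πk = shift n k P` are complex).  The sum is a `tsum`:
it is the finite sum over the support for finitely supported `φ` (`ftSum_eq_sum`) and converges absolutely at every real
`p` for `φ ∈ ℓ¹(ℤ^d)` (`summable_ftTerm_ofRealVec`); elsewhere it carries the junk value `0` of `tsum`.
[cite: Balaban1983RegularityDecay, (2.43) p.584] -/
def ftSum (n : ℕ) (φ : (Fin d → ℤ) → ℂ) (p : Fin d → ℂ) : ℂ :=
  ((n : ℂ) ^ d)⁻¹ * ∑' z : Fin d → ℤ, ftTerm n φ p z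

/-- unfolding of `ftSum`. [cite: Balaban1983RegularityDecay, (2.43) p.584] -/
theorem ftSum_def (n : ℕ) (φ : (Fin d → ℤ) → ℂ) (p : Fin d → ℂ) :
    ftSum n φ p = ((n : ℂ) ^ d)⁻¹ * ∑' z : Fin d → ℤ, cexp (-(I * phaseC p z / n)) * φ z := rfl

/-- for a finitely supported `φ` (vanishing off a finite set `S`) the transform is the finite sum `ξ^d Σ_{z∈S} e^{−ip·ξz}φ(z)`,
at EVERY complex momentum. [cite: Balaban1983RegularityDecay, (2.43) p.584] -/
theorem ftSum_eq_sum (n : ℕ) {φ : (Fin d → ℤ) → ℂ} {S : Finset (Fin d → ℤ)} (hS : ∀ z ∉ S, φ z = 0) (p : Fin d → ℂ) :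
    ftSum n φ p = ((n : ℂ) ^ d)⁻¹ * ∑ z ∈ S, cexp (-(I * phaseC p z / n)) * φ z := by
  rw [ftSum_def, tsum_eq_sum]
  intro z hz
  rw [hS z hz, mul_zero]

/-- the transform of a finitely supported function is an entire function of the complex momentum. [cite: Balaban1983RegularityDecay, (2.43) p.584] -/
theorem differentiable_ftSum (n : ℕ) {φ : (Fin d → ℤ) → ℂ} {S : Finset (Fin d → ℤ)} (hS : ∀ z ∉ S, φ z = 0) :
    Differentiable ℂ (ftSum n φ) := by
  have h : ftSum n φ = fun p => ((n : ℂ) ^ d)⁻¹ * ∑ z ∈ S, cexp (-(I * phaseC p z / n)) * φ z := by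
    funext p; exact ftSum_eq_sum n hS p
  rw [h]
  refine Differentiable.const_mul (Differentiable.fun_sum fun z _ => ?_) _
  unfold phaseC
  fun_prop

/-- at a real momentum the series (2.43) of an `ℓ¹` function converges absolutely. [cite: Balaban1983RegularityDecay, (2.43) p.584] -/
theorem summable_ftTerm_ofRealVec (n : ℕ) {φ : (Fin d → ℤ) → ℂ} (hφ : Summable fun z => ‖φ z‖) (p : Fin d → ℝ) :
    Summable (ftTerm n φ (ofRealVec p)) := by
  refine Summable.of_norm_bounded hφ fun z => ?_
  unfold ftTerm
  rw [norm_mul, norm_cexp_neg_phaseC_ofRealVec, one_mul]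

/-- a finitely supported function has an (absolutely) summable series (2.43) at every complex momentum. [cite: Balaban1983RegularityDecay, (2.43) p.584] -/
theorem summable_ftTerm_of_support (n : ℕ) {φ : (Fin d → ℤ) → ℂ} {S : Finset (Fin d → ℤ)} (hS : ∀ z ∉ S, φ z = 0)
    (p : Fin d → ℂ) : Summable (ftTerm n φ p) := by
  refine summable_of_ne_finset_zero (s := S) fun z hz => ?_
  unfold ftTerm
  rw [hS z hz, mul_zero]

/-- a finitely supported function is in `ℓ¹`. [folklore] -/
private theorem summable_norm_of_support {φ : (Fin d → ℤ) → ℂ} {S : Finset (Fin d → ℤ)} (hS : ∀ z ∉ S, φ z = 0) :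
    Summable fun z => ‖φ z‖ :=
  summable_of_ne_finset_zero (s := S) fun z hz => by rw [hS z hz, norm_zero]

/-- the transform of a point mass `c·δ_{z₀}`: `ξ^d c e^{−ip·ξz₀}` (in particular the transform is not the zero map).
[cite: Balaban1983RegularityDecay, (2.43) p.584] -/
theorem ftSum_single (n : ℕ) (z₀ : Fin d → ℤ) (c : ℂ) (p : Fin d → ℂ) :
    ftSum n (fun z => if z = z₀ then c else 0) p = ((n : ℂ) ^ d)⁻¹ * (cexp (-(I * phaseC p z₀ / n)) * c) := by
  rw [ftSum_eq_sum n (S := {z₀}) (fun z hz => if_neg (by simpa using hz)) p, Finset.sum_singleton, if_pos rfl]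

/-- **bridge to the B4 owner's finitely-supported transform** `B4Eq243Transform.ft n S f P = Σ_{z∈S} ξ^d e^{−iP·z} f(z)`
(support `S` a datum, unit-zone variable `P = ξp`): for `f` vanishing off `S`, `ftSum n f p = ft n S f (ξp)` read at `p = nP`,
i.e. the two bodies of (2.43) in the tree agree — `ftSum` is `ft` freed from the support datum and extended to summable `f`.
[cite: Balaban1983RegularityDecay, (2.43) p.584] -/
theorem ftSum_eq_ft (n : ℕ) {S : Finset (Fin d → ℤ)} {f : (Fin d → ℤ) → ℂ} (hf : ∀ z ∉ S, f z = 0) (hn : n ≠ 0)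
    (P : Fin d → ℂ) : ftSum n f (fun μ => (n : ℂ) * P μ) = ft n S f P := by
  have hn' : (n : ℂ) ≠ 0 := Nat.cast_ne_zero.mpr hn
  rw [ftSum_eq_sum n hf, ft_apply, Finset.mul_sum]
  refine Finset.sum_congr rfl fun z _ => ?_
  rw [phaseC_smul, phaseC_neg, mul_div_assoc, mul_div_cancel_left₀ _ hn', mul_neg, mul_assoc]

/-- the same bridge read at a fine momentum: `ft n S f (p/n) = ftSum n f p`. [cite: Balaban1983RegularityDecay, (2.43) p.584] -/
theorem ft_eq_ftSum (n : ℕ) {S : Finset (Fin d → ℤ)} {f : (Fin d → ℤ) → ℂ} (hf : ∀ z ∉ S, f z = 0) (hn : n ≠ 0)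
    (p : Fin d → ℂ) : ft n S f (fun μ => p μ / n) = ftSum n f p := by
  have hn' : (n : ℂ) ≠ 0 := Nat.cast_ne_zero.mpr hn
  rw [← ftSum_eq_ft n hf hn]
  congr 1
  funext μ
  rw [mul_div_cancel₀ _ hn']

/-- **bridge to the tree's lattice transform** (`Literature.Analysis.FunctionSpaces.Lattice.fourier a k = Σ_x a(x)e^{ik·x}`,
Madras–Slade sign, unit lattice): at a real momentum `f̃(p) = ξ^d · (Lattice.fourier f)(−ξp)` — print's (2.43) is the
standard Fourier series of `f : ℤ^d → ℂ` read at `k = −p/n` and weighted by `ξ^d`. [cite: Balaban1983RegularityDecay, (2.43) p.584] -/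
theorem ftSum_ofRealVec_eq_fourier (n : ℕ) (φ : (Fin d → ℤ) → ℂ) (p : Fin d → ℝ) :
    ftSum n φ (ofRealVec p)
      = ((n : ℂ) ^ d)⁻¹ * Literature.Analysis.FunctionSpaces.Lattice.fourier φ (fun μ => -(p μ) / n) := by
  rw [ftSum_def, Literature.Analysis.FunctionSpaces.Lattice.fourier]
  congr 1
  refine tsum_congr fun z => ?_
  rw [mul_comm, phaseC_ofRealVec]
  congr 2
  unfold phase
  push_cast
  simp only [Finset.mul_sum, Finset.sum_div, Finset.sum_mul, ← Finset.sum_neg_distrib]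
  refine Finset.sum_congr rfl fun μ _ => ?_
  ring

/-! ### §3 Linearity and the translation law -/

/-- the transform of the zero function. [cite: Balaban1983RegularityDecay, (2.43) p.584] -/
theorem ftSum_zero (n : ℕ) (p : Fin d → ℂ) : ftSum n (fun _ => (0 : ℂ)) p = 0 := by
  rw [ftSum_def]; simp

/-- additivity (both series convergent). [cite: Balaban1983RegularityDecay, (2.43) p.584] -/
theorem ftSum_add (n : ℕ) {φ ψ : (Fin d → ℤ) → ℂ} {p : Fin d → ℂ} (hφ : Summable (ftTerm n φ p))
    (hψ : Summable (ftTerm n ψ p)) : ftSum n (fun z => φ z + ψ z) p = ftSum n φ p + ftSum n ψ p := by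
  simp only [ftSum]
  rw [← mul_add, ← hφ.tsum_add hψ]
  congr 1
  refine tsum_congr fun z => ?_
  simp only [ftTerm]; ring

/-- subtractivity (both series convergent). [cite: Balaban1983RegularityDecay, (2.43) p.584] -/
theorem ftSum_sub (n : ℕ) {φ ψ : (Fin d → ℤ) → ℂ} {p : Fin d → ℂ} (hφ : Summable (ftTerm n φ p))
    (hψ : Summable (ftTerm n ψ p)) : ftSum n (fun z => φ z - ψ z) p = ftSum n φ p - ftSum n ψ p := by
  simp only [ftSum]
  rw [← mul_sub, ← hφ.tsum_sub hψ]
  congr 1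
  refine tsum_congr fun z => ?_
  simp only [ftTerm]; ring

/-- homogeneity (no convergence needed). [cite: Balaban1983RegularityDecay, (2.43) p.584] -/
theorem ftSum_const_mul (n : ℕ) (c : ℂ) (φ : (Fin d → ℤ) → ℂ) (p : Fin d → ℂ) :
    ftSum n (fun z => c * φ z) p = c * ftSum n φ p := by
  simp only [ftSum, ftTerm]
  rw [show (fun z => cexp (-(I * phaseC p z / n)) * (c * φ z))
      = fun z => c * (cexp (-(I * phaseC p z / n)) * φ z) from funext fun z => by ring, tsum_mul_left]
  ring

/-- finite linear combinations (all series convergent). [cite: Balaban1983RegularityDecay, (2.43) p.584] -/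
theorem ftSum_finset_sum (n : ℕ) {ι : Type*} (s : Finset ι) {φ : ι → (Fin d → ℤ) → ℂ} {p : Fin d → ℂ}
    (h : ∀ i ∈ s, Summable (ftTerm n (φ i) p)) :
    ftSum n (fun z => ∑ i ∈ s, φ i z) p = ∑ i ∈ s, ftSum n (φ i) p := by
  classical
  induction s using Finset.induction_on with
  | empty => simp [ftSum_zero]
  | insert i s hi ih =>
    have hs : ∀ j ∈ s, Summable (ftTerm n (φ j) p) := fun j hj => h j (Finset.mem_insert_of_mem hj)
    have hsum : Summable (ftTerm n (fun z => ∑ j ∈ s, φ j z) p) := by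
      have : ftTerm n (fun z => ∑ j ∈ s, φ j z) p = fun z => ∑ j ∈ s, ftTerm n (φ j) p z := by
        funext z; simp only [ftTerm, Finset.mul_sum]
      rw [this]
      exact summable_sum fun j hj => hs j hj
    simp_rw [Finset.sum_insert hi]
    rw [ftSum_add n (h i (Finset.mem_insert_self i s)) hsum, ih hs]

/-- **translation law**: `(f(· + s))~(p) = e^{ip·ξs} f̃(p)` for every complex `p` and every `φ` (a re-indexing of the
series, no convergence needed). [cite: Balaban1983RegularityDecay, (2.43) p.584] -/
theorem ftSum_comp_add (n : ℕ) (φ : (Fin d → ℤ) → ℂ) (s : Fin d → ℤ) (p : Fin d → ℂ) :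
    ftSum n (fun z => φ (z + s)) p = cexp (I * phaseC p s / n) * ftSum n φ p := by
  simp only [ftSum, ftTerm]
  have h := (Equiv.addRight s).tsum_eq (fun w : Fin d → ℤ => cexp (-(I * phaseC p (w - s) / n)) * φ w)
  simp only [Equiv.coe_addRight, add_sub_cancel_right] at h
  rw [h]
  have h2 : (fun b => cexp (-(I * phaseC p (b - s) / n)) * φ b)
      = fun b => cexp (I * phaseC p s / n) * (cexp (-(I * phaseC p b / n)) * φ b) := by
    funext b
    rw [phaseC_sub, ← mul_assoc, ← Complex.exp_add]
    congr 2
    ring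
  rw [h2, tsum_mul_left]
  ring

/-- translation law, backward shift: `(f(· − s))~(p) = e^{−ip·ξs} f̃(p)`. [cite: Balaban1983RegularityDecay, (2.43) p.584] -/
theorem ftSum_comp_sub (n : ℕ) (φ : (Fin d → ℤ) → ℂ) (s : Fin d → ℤ) (p : Fin d → ℂ) :
    ftSum n (fun z => φ (z - s)) p = cexp (-(I * phaseC p s / n)) * ftSum n φ p := by
  have h := ftSum_comp_add n φ (-s) p
  rw [phaseC_neg] at h
  simp only [sub_eq_add_neg]
  rw [h]
  congr 2
  ring

/-- the series of a translate converges iff the original one does (forward). [cite: Balaban1983RegularityDecay, (2.43) p.584] -/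
theorem summable_ftTerm_comp_add (n : ℕ) {φ : (Fin d → ℤ) → ℂ} {p : Fin d → ℂ} (hφ : Summable (ftTerm n φ p))
    (s : Fin d → ℤ) : Summable (ftTerm n (fun z => φ (z + s)) p) := by
  have h : ftTerm n (fun z => φ (z + s)) p
      = fun z => cexp (I * phaseC p s / n) * ((ftTerm n φ p) ∘ (Equiv.addRight s)) z := by
    funext z
    simp only [ftTerm, Function.comp, Equiv.coe_addRight, phaseC_add]
    rw [← mul_assoc, ← Complex.exp_add]
    congr 2
    ring
  rw [h]
  exact ((Equiv.addRight s).summable_iff.mpr hφ).mul_left _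

/-- the series of a translate converges iff the original one does (backward). [cite: Balaban1983RegularityDecay, (2.43) p.584] -/
theorem summable_ftTerm_comp_sub (n : ℕ) {φ : (Fin d → ℤ) → ℂ} {p : Fin d → ℂ} (hφ : Summable (ftTerm n φ p))
    (s : Fin d → ℤ) : Summable (ftTerm n (fun z => φ (z - s)) p) := by
  simpa only [sub_eq_add_neg] using summable_ftTerm_comp_add n hφ (-s)

/-- `2πn`-periodicity in each momentum component: `f̃(p + 2πn e_μ) = f̃(p)` (so the fibre representatives
`k_μ ∈ {0,…,n−1}` of `B4Strip.shift` and print's symmetric range of `m′_μ` give the same values). [cite: Balaban1983RegularityDecay, (2.43), (2.45) p.584] -/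
theorem ftSum_periodic (n : ℕ) (hn : n ≠ 0) (φ : (Fin d → ℤ) → ℂ) (p : Fin d → ℂ) (μ : Fin d) :
    ftSum n φ (p + Pi.single μ (2 * π * (n : ℂ))) = ftSum n φ p := by
  have hn' : (n : ℂ) ≠ 0 := Nat.cast_ne_zero.mpr hn
  simp only [ftSum, ftTerm]
  congr 1
  refine tsum_congr fun z => ?_
  congr 1
  have hph : phaseC (p + Pi.single μ (2 * π * (n : ℂ))) z = phaseC p z + 2 * π * n * (z μ : ℂ) := by
    unfold phaseC
    simp only [Pi.add_apply, add_mul, Finset.sum_add_distrib]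
    congr 1
    rw [Finset.sum_eq_single μ]
    · rw [Pi.single_eq_same]
    · intro ν _ hν; rw [Pi.single_eq_of_ne hν, zero_mul]
    · intro h; exact absurd (Finset.mem_univ μ) h
  rw [hph, show -(I * (phaseC p z + 2 * π * n * (z μ : ℂ)) / n) = -(I * phaseC p z / n) + ((-z μ : ℤ) : ℂ) * (2 * π * I) by
    push_cast; field_simp; ring]
  rw [Complex.exp_add, Complex.exp_int_mul_two_pi_mul_I, mul_one]

/-- the series of a scalar multiple converges. [cite: Balaban1983RegularityDecay, (2.43) p.584] -/
theorem summable_ftTerm_const_mul (n : ℕ) (c : ℂ) {φ : (Fin d → ℤ) → ℂ} {p : Fin d → ℂ}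
    (hφ : Summable (ftTerm n φ p)) : Summable (ftTerm n (fun z => c * φ z) p) := by
  have h : ftTerm n (fun z => c * φ z) p = fun z => c * ftTerm n φ p z := by
    funext z; simp only [ftTerm]; ring
  rw [h]
  exact hφ.mul_left c

/-- the series of a difference converges. [cite: Balaban1983RegularityDecay, (2.43) p.584] -/
theorem summable_ftTerm_sub (n : ℕ) {φ ψ : (Fin d → ℤ) → ℂ} {p : Fin d → ℂ} (hφ : Summable (ftTerm n φ p))
    (hψ : Summable (ftTerm n ψ p)) : Summable (ftTerm n (fun z => φ z - ψ z) p) := by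
  have h : ftTerm n (fun z => φ z - ψ z) p = fun z => ftTerm n φ p z - ftTerm n ψ p z := by
    funext z; simp only [ftTerm]; ring
  rw [h]
  exact hφ.sub hψ

/-- the series of a sum converges. [cite: Balaban1983RegularityDecay, (2.43) p.584] -/
theorem summable_ftTerm_add (n : ℕ) {φ ψ : (Fin d → ℤ) → ℂ} {p : Fin d → ℂ} (hφ : Summable (ftTerm n φ p))
    (hψ : Summable (ftTerm n ψ p)) : Summable (ftTerm n (fun z => φ z + ψ z) p) := by
  have h : ftTerm n (fun z => φ z + ψ z) p = fun z => ftTerm n φ p z + ftTerm n ψ p z := by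
    funext z; simp only [ftTerm]; ring
  rw [h]
  exact hφ.add hψ

/-! ### §4 (2.45), first summand: the symbol of `−Δ^ξ + m²` -/

/-- the one-direction second difference `2φ − φ(·+e_μ) − φ(·−e_μ)` has transform `(2 − e^{iξp_μ} − e^{−iξp_μ})·φ̃`.
[cite: Balaban1983RegularityDecay, (2.45) p.584] -/
theorem ftSum_secondDiff (n : ℕ) {φ : (Fin d → ℤ) → ℂ} {p : Fin d → ℂ} (hφ : Summable (ftTerm n φ p)) (μ : Fin d) :
    ftSum n (fun z => 2 * φ z - φ (z + e μ) - φ (z - e μ)) p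
      = (2 - cexp (I * p μ / n) - cexp (-(I * p μ / n))) * ftSum n φ p := by
  have hA : Summable (ftTerm n (fun z => 2 * φ z) p) := summable_ftTerm_const_mul n 2 hφ
  have hB : Summable (ftTerm n (fun z => φ (z + e μ)) p) := summable_ftTerm_comp_add n hφ (e μ)
  have hC : Summable (ftTerm n (fun z => φ (z - e μ)) p) := summable_ftTerm_comp_sub n hφ (e μ)
  have hAB : Summable (ftTerm n (fun z => 2 * φ z - φ (z + e μ)) p) := summable_ftTerm_sub n hA hB
  rw [ftSum_sub n hAB hC, ftSum_sub n hA hB, ftSum_const_mul, ftSum_comp_add, ftSum_comp_sub, phaseC_e]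
  ring

/-- the series of `−Δ^ξφ` converges where that of `φ` does. [cite: Balaban1983RegularityDecay, (2.45) p.584] -/
theorem summable_ftTerm_negLap (n : ℕ) {φ : (Fin d → ℤ) → ℂ} {p : Fin d → ℂ} (hφ : Summable (ftTerm n φ p)) :
    Summable (ftTerm n (negLap n φ) p) := by
  have h : ftTerm n (negLap n φ) p = fun z => (n : ℂ) ^ 2 * ∑ μ, (2 * ftTerm n φ p z
      - ftTerm n (fun z => φ (z + e μ)) p z - ftTerm n (fun z => φ (z - e μ)) p z) := by
    funext z
    simp only [ftTerm, negLap, Finset.mul_sum]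
    refine Finset.sum_congr rfl fun μ _ => ?_
    ring
  rw [h]
  refine Summable.mul_left _ (summable_sum fun μ _ => ?_)
  exact ((hφ.mul_left 2).sub (summable_ftTerm_comp_add n hφ (e μ))).sub (summable_ftTerm_comp_sub n hφ (e μ))

/-- **(2.45), FIRST SUMMAND — the symbol of `−Δ^ξ`**: `(−Δ^ξφ)~(p) = Σ_μ |(e^{−iξp_μ} − 1)/ξ|² · φ̃(p)`
(`= Σ_μ S_ξ(p_μ) · φ̃(p)`, `S_ξ = B4Strip.Sxi n`, `−Δ^ξ = B4Green244.negLap n`), at every complex momentum `p` at which the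
series (2.43) of `φ` converges — the plane-wave eigenvalue of `B4Green244.lap_PhZ` for a general transformable `φ`.
[cite: Balaban1983RegularityDecay, (2.45) p.584] -/
theorem ftSum_negLap (n : ℕ) {φ : (Fin d → ℤ) → ℂ} {p : Fin d → ℂ} (hφ : Summable (ftTerm n φ p)) :
    ftSum n (negLap n φ) p = (∑ μ, Sxi n (p μ)) * ftSum n φ p := by
  set g : Fin d → (Fin d → ℤ) → ℂ := fun μ z => 2 * φ z - φ (z + e μ) - φ (z - e μ) with hg
  have hfun : negLap n φ = fun z => (n : ℂ) ^ 2 * ∑ μ ∈ Finset.univ, g μ z := by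
    funext z; rfl
  have hgs : ∀ μ ∈ (Finset.univ : Finset (Fin d)), Summable (ftTerm n (g μ) p) := fun μ _ =>
    summable_ftTerm_sub n (summable_ftTerm_sub n (summable_ftTerm_const_mul n 2 hφ)
      (summable_ftTerm_comp_add n hφ (e μ))) (summable_ftTerm_comp_sub n hφ (e μ))
  rw [hfun, ftSum_const_mul, ftSum_finset_sum n Finset.univ hgs, Finset.mul_sum, Finset.sum_mul]
  refine Finset.sum_congr rfl fun μ _ => ?_
  rw [hg, ftSum_secondDiff n hφ μ, Sxi_eq_sq_mul_S1, ← two_sub_exp]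
  ring_nf

/-- **(2.45), FIRST SUMMAND WITH THE MASS**: `(−Δ^ξφ + m²φ)~(p) = Δ^ξ(p)·φ̃(p)` with print's
`Δ^ξ(p) = Σ_μ |(e^{−iξp_μ} − 1)/ξ|² + m²` = `B4Strip.DeltaXi n m² p`. [cite: Balaban1983RegularityDecay, (2.45) p.584] -/
theorem ftSum_negLap_add_mass (n : ℕ) (m2 : ℝ) {φ : (Fin d → ℤ) → ℂ} {p : Fin d → ℂ} (hφ : Summable (ftTerm n φ p)) :
    ftSum n (fun z => negLap n φ z + m2 * φ z) p = DeltaXi n m2 p * ftSum n φ p := by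
  rw [ftSum_add n (summable_ftTerm_negLap n hφ) (summable_ftTerm_const_mul n m2 hφ), ftSum_negLap n hφ, ftSum_const_mul]
  unfold DeltaXi
  ring

/-! ### §5 (2.43), second formula: the inversion theorem -/

/-- a plane wave at a real momentum has modulus one. [folklore] -/
private theorem norm_cexp_I_phase (q : Fin d → ℝ) (x : Fin d → ℤ) : ‖cexp (I * phase q x)‖ = 1 := by
  have h : I * phase q x = ((∑ μ, q μ * (x μ : ℝ) : ℝ) : ℂ) * I := by
    unfold phase; push_cast; ring
  rw [h, Complex.norm_exp_ofReal_mul_I]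

/-- the Brillouin zone is measurable. [folklore] -/
private theorem measurableSet_BZ : MeasurableSet (BZ d) := by
  unfold BZ; exact measurableSet_Icc

/-- the volume of the Brillouin zone `[−π,π]^d` is `(2π)^d`. [folklore] -/
private theorem volume_real_BZ : (volume : Measure (Fin d → ℝ)).real (BZ d) = (2 * π) ^ d := by
  rw [measureReal_def]
  unfold BZ
  rw [Real.volume_Icc_pi_toReal]
  · simp only [sub_neg_eq_add, Finset.prod_const, Finset.card_univ, Fintype.card_fin]
    ring
  · intro i; simp only; linarith [Real.pi_pos]

/-- THE HEART OF THE INVERSION: the lattice kernel of the absolutely convergent Fourier series `P ↦ Σ_y e^{−iP·y} φ(y)` of an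
`ℓ¹` function is the function itself: `(2π)^{−d}∫_{[−π,π]^d} (Σ_y e^{−iP·y}φ(y)) e^{iP·z} dP = φ(z)` (term-wise integration
of the dominated series and `∫ e^{iP·(z−y)} = (2π)^d δ_{zy}`). [cite: Balaban1983RegularityDecay, (2.43) p.584] -/
theorem latticeKernel_tsum_phase {φ : (Fin d → ℤ) → ℂ} (hφ : Summable fun z => ‖φ z‖) (z : Fin d → ℤ) :
    latticeKernel (fun P => ∑' y, cexp (-(I * phaseC P y)) * φ y) z = φ z := by
  -- the term family `F y q = φ(y) · [e^{−iq·y} e^{iq·z}]`, integrated over the zone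
  have hint : ∀ y, Integrable (fun q => φ y * integrand (fun P => cexp (I * phaseC P (-y))) z q)
      (volume.restrict (BZ d)) := by
    intro y
    have h1 : IntegrableOn (integrand (fun P => cexp (I * phaseC P (-y))) z) (BZ d) := by
      refine integrableOn_of_differentiableAt (fun p _ => ?_) z
      unfold phaseC; fun_prop
    exact h1.const_mul (φ y)
  have hnorm : ∀ y q, ‖φ y * integrand (fun P => cexp (I * phaseC P (-y))) z q‖ = ‖φ y‖ := by
    intro y q
    simp only [integrand, norm_mul]
    rw [show I * phaseC (ofRealVec q) (-y) = I * phase q (-y) from rfl, norm_cexp_I_phase, norm_cexp_I_phase]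
    ring
  have hsum : Summable fun y => ∫ q in BZ d, ‖φ y * integrand (fun P => cexp (I * phaseC P (-y))) z q‖ := by
    simp_rw [hnorm, MeasureTheory.setIntegral_const, volume_real_BZ, smul_eq_mul]
    exact hφ.mul_left _
  -- the integrand of the kernel is the series of the `F y`
  have hser : ∀ q, integrand (fun P => ∑' y, cexp (-(I * phaseC P y)) * φ y) z q
      = ∑' y, φ y * integrand (fun P => cexp (I * phaseC P (-y))) z q := by
    intro q
    simp only [integrand]
    rw [← tsum_mul_right]
    refine tsum_congr fun y => ?_
    rw [phaseC_neg]
    ring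
  -- term-wise: `∫ F y = φ y · (2π)^d · δ_{z,y}`
  have h2c : ((2 * (π : ℂ)) ^ d) ≠ 0 :=
    pow_ne_zero _ (mul_ne_zero two_ne_zero (Complex.ofReal_ne_zero.mpr Real.pi_ne_zero))
  have hterm : ∀ y, ∫ q in BZ d, φ y * integrand (fun P => cexp (I * phaseC P (-y))) z q
      = φ y * ((2 * (π : ℂ)) ^ d * if z = y then (1 : ℂ) else 0) := by
    intro y
    rw [MeasureTheory.integral_const_mul]
    congr 1
    have hk := latticeKernel_phase (-y) z
    unfold latticeKernel fourierBox at hk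
    rw [Complex.real_smul] at hk
    push_cast at hk
    rw [show (if z = y then (1 : ℂ) else 0) = if z + -y = 0 then 1 else 0 by simp only [add_neg_eq_zero], ← hk,
      ← mul_assoc, mul_inv_cancel₀ h2c, one_mul]
  unfold latticeKernel fourierBox
  simp_rw [hser]
  rw [← integral_tsum_of_summable_integral_norm hint hsum]
  simp_rw [hterm]
  rw [tsum_eq_single z (fun y hy => by rw [if_neg (Ne.symm hy), mul_zero, mul_zero]), if_pos rfl, mul_one,
    Complex.real_smul]
  push_cast
  rw [mul_left_comm, inv_mul_cancel₀ h2c, mul_one]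

/-- a real vector scaled by `n`, coordinatewise, read in `ℂ^d`. [folklore] -/
private theorem ofRealVec_nsmul (n : ℕ) (q : Fin d → ℝ) : ofRealVec ((n : ℝ) • q) = fun μ => (n : ℂ) * ofRealVec q μ := by
  funext μ
  simp [ofRealVec]

/-- the phase scales with the momentum: `(nq)·x = n(q·x)`. [folklore] -/
private theorem phase_nsmul (n : ℕ) (q : Fin d → ℝ) (x : Fin d → ℤ) : phase ((n : ℝ) • q) x = (n : ℂ) * phase q x := by
  unfold phase
  rw [Finset.mul_sum]
  refine Finset.sum_congr rfl fun μ _ => ?_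
  simp only [Pi.smul_apply, smul_eq_mul]
  push_cast
  ring

/-- **(2.43), SECOND FORMULA, `latticeKernel` FORM**: for `φ ∈ ℓ¹(ℤ^d)`, `φ(z) = (2π)^{−d}∫_{[−π,π]^d} ξ^{−d} f̃(P/ξ) e^{iP·z} dP`,
i.e. `φ` is the `B4ContourShift.latticeKernel` of the multiplier `P ↦ n^d · ftSum n φ (nP)` (the printed integral over
`|p| ≤ π/ξ` after the substitution `p = P/ξ`). [cite: Balaban1983RegularityDecay, (2.43) p.584] -/
theorem ftSum_inversion_latticeKernel (n : ℕ) (hn : n ≠ 0) {φ : (Fin d → ℤ) → ℂ} (hφ : Summable fun z => ‖φ z‖)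
    (z : Fin d → ℤ) : φ z = latticeKernel (fun P => (n : ℂ) ^ d * ftSum n φ (fun μ => (n : ℂ) * P μ)) z := by
  have hn' : (n : ℂ) ≠ 0 := Nat.cast_ne_zero.mpr hn
  have h : (fun P : Fin d → ℂ => (n : ℂ) ^ d * ftSum n φ (fun μ => (n : ℂ) * P μ))
      = fun P => ∑' y, cexp (-(I * phaseC P y)) * φ y := by
    funext P
    rw [ftSum_def, ← mul_assoc, mul_inv_cancel₀ (pow_ne_zero _ hn'), one_mul]
    refine tsum_congr fun y => ?_
    rw [phaseC_smul, mul_div_assoc, mul_div_cancel_left₀ _ hn']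
  rw [h, latticeKernel_tsum_phase hφ z]

/-- the big zone `|p_μ| ≤ π/ξ = nπ` of (2.43) (a cube, like `B4ContourShift.BZ`). [cite: Balaban1983RegularityDecay, (2.43) p.584] -/
def bigZone (d n : ℕ) : Set (Fin d → ℝ) := Set.Icc (fun _ => -((n : ℝ) * π)) (fun _ => (n : ℝ) * π)

/-- the big zone is measurable. [folklore] -/
private theorem measurableSet_bigZone (n : ℕ) : MeasurableSet (bigZone d n) := by
  unfold bigZone; exact measurableSet_Icc

/-- `p = nq` lies in the big zone iff `q` lies in the Brillouin zone (`n ≥ 1`). [folklore] -/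
private theorem smul_mem_bigZone_iff (n : ℕ) (hn : 0 < n) (q : Fin d → ℝ) : (n : ℝ) • q ∈ bigZone d n ↔ q ∈ BZ d := by
  have hnr : (0 : ℝ) < n := by exact_mod_cast hn
  simp only [bigZone, BZ, Set.mem_Icc, Pi.le_def, Pi.smul_apply, smul_eq_mul]
  constructor
  · rintro ⟨h1, h2⟩
    refine ⟨fun μ => ?_, fun μ => ?_⟩
    · have := h1 μ; nlinarith
    · have := h2 μ; nlinarith
  · rintro ⟨h1, h2⟩
    refine ⟨fun μ => ?_, fun μ => ?_⟩
    · have := h1 μ; nlinarith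
    · have := h2 μ; nlinarith

/-- **(2.43), SECOND FORMULA, AS PRINTED — THE INVERSION THEOREM.**  For `φ ∈ ℓ¹(ℤ^d)` (`Σ_z |φ(z)| < ∞`), every `n ≥ 1` and
every fine point `x = ξz`:
`f(x) = (2π)^{−d} ∫_{|p|≤π/ξ} e^{ix·p} f̃(p) dp`, the integral over the cube `|p_μ| ≤ nπ` of `e^{ip·z/n} f̃(p)`.
[cite: Balaban1983RegularityDecay, (2.43) p.584] -/
theorem ftSum_inversion (n : ℕ) (hn : 0 < n) {φ : (Fin d → ℤ) → ℂ} (hφ : Summable fun z => ‖φ z‖) (z : Fin d → ℤ) :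
    φ z = ((2 * (π : ℂ)) ^ d)⁻¹ * ∫ p in bigZone d n, cexp (I * phase p z / n) * ftSum n φ (ofRealVec p) := by
  have hn0 : n ≠ 0 := Nat.pos_iff_ne_zero.mp hn
  have hnc : (n : ℂ) ≠ 0 := Nat.cast_ne_zero.mpr hn0
  -- the pull-back of the printed integrand to the unit zone
  have hpull : ∀ q : Fin d → ℝ,
      (bigZone d n).indicator (fun p => cexp (I * phase p z / n) * ftSum n φ (ofRealVec p)) ((n : ℝ) • q)
        = (BZ d).indicator (fun q => cexp (I * phase q z) * ftSum n φ (fun μ => (n : ℂ) * ofRealVec q μ)) q := by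
    intro q
    by_cases hq : q ∈ BZ d
    · rw [Set.indicator_of_mem ((smul_mem_bigZone_iff n hn q).mpr hq), Set.indicator_of_mem hq, ofRealVec_nsmul,
        phase_nsmul, mul_div_assoc, mul_div_cancel_left₀ _ hnc]
    · rw [Set.indicator_of_notMem (fun h => hq ((smul_mem_bigZone_iff n hn q).mp h)), Set.indicator_of_notMem hq]
  -- change of variables `p = n q`
  have hcov := MeasureTheory.Measure.integral_comp_smul (volume : Measure (Fin d → ℝ))
    ((bigZone d n).indicator (fun p => cexp (I * phase p z / n) * ftSum n φ (ofRealVec p))) (n : ℝ)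
  simp only [Module.finrank_fintype_fun_eq_card, Fintype.card_fin] at hcov
  rw [abs_of_pos (by positivity)] at hcov
  simp_rw [hpull] at hcov
  rw [MeasureTheory.integral_indicator measurableSet_BZ, MeasureTheory.integral_indicator (measurableSet_bigZone n)]
    at hcov
  -- `∫_{big} (printed integrand) = n^d ∫_{BZ} (pull-back)`
  have hbig : ∫ p in bigZone d n, cexp (I * phase p z / n) * ftSum n φ (ofRealVec p)
      = (n : ℂ) ^ d * ∫ q in BZ d, cexp (I * phase q z) * ftSum n φ (fun μ => (n : ℂ) * ofRealVec q μ) := by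
    rw [hcov, Complex.real_smul]
    push_cast
    rw [← mul_assoc, mul_inv_cancel₀ (pow_ne_zero _ hnc), one_mul]
  rw [hbig, ← MeasureTheory.integral_const_mul, ftSum_inversion_latticeKernel n hn0 hφ z]
  unfold latticeKernel fourierBox integrand
  rw [Complex.real_smul]
  push_cast
  congr 1
  refine MeasureTheory.setIntegral_congr_fun measurableSet_BZ fun q _ => ?_
  ring

/-! ### §6 Injectivity on `ℓ¹` -/

/-- **uniqueness**: two `ℓ¹` functions on the fine lattice with the same transform on the big zone `|p_μ| ≤ nπ` are equal.
[cite: Balaban1983RegularityDecay, (2.43) p.584] -/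
theorem eq_of_ftSum_eq (n : ℕ) (hn : n ≠ 0) {φ ψ : (Fin d → ℤ) → ℂ} (hφ : Summable fun z => ‖φ z‖)
    (hψ : Summable fun z => ‖ψ z‖) (h : ∀ p ∈ bigZone d n, ftSum n φ (ofRealVec p) = ftSum n ψ (ofRealVec p)) : φ = ψ := by
  funext z
  rw [ftSum_inversion_latticeKernel n hn hφ z, ftSum_inversion_latticeKernel n hn hψ z]
  refine latticeKernel_congr (fun q hq => ?_) z
  rw [← ofRealVec_nsmul, h _ ((smul_mem_bigZone_iff n (Nat.pos_of_ne_zero hn) q).mpr hq)]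

end

end Literature.MathematicalPhysics.QuantumFieldTheory.Balaban1983to89.B4Eq243TransformSummable
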